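import Summits.AnomalousDissipation.AnomalousDissipation.Theorems.SolenoidalFractalHomogenisationLagrangianStepVmodCoarseDecay
import Summits.AnomalousDissipation.AnomalousDissipation.Theorems.SolenoidalFractalHomogenisationLagrangianStepN1Assembly
import Literature.Analysis.FluidPDE.PassiveVectorTensorTwoProblemDuality
import Literature.Analysis.FluidPDE.PassiveVectorTensorPropagatorBandKill
import Literature.Analysis.FluidPDE.PassiveVectorTensorWeightedDecay
import HarnessLib

/-!
# K1L_D (stmt-AnomalousDissipation-27980): (V_mod) flat stage — the TRANSPORT-ONLY DUALITY BOUND of a window propagator against the drift-free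
# propagator of the SAME tensor: `|⟪U x, ζ⟫ − ⟪V x, ζ⟫| ≤ 3·B·(t−s)·‖x‖·‖∇ζ‖₂`
(line file of the (V_mod) lane, short-window engine F4a of the (ff) block (and of (fs)/(sf)/(ss)); prover ad-k3l-bookkeeping-p1 g9.)

For a propagator `U` with a bounded (`‖b‖ ≤ B`), a.e. weakly divergence-free carrier and an elliptic constant tensor `𝔹`, and the propagator `V` of the
SAME tensor WITHOUT drift, the two-problem duality of `PassiveVectorTensorTwoProblemDuality` (Temam III.1.2 in Galerkin form, traces included) has NO
viscous cross term (`T_𝔹 − T_𝔹 = 0`): testing against the drift-free adjoint evolution `ψ` of `ζ` leaves only the transport remainder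
`Σ_k Σ_j Re(2πik_j⟨𝓕(b_j u)(k), ψ̂(k)⟩)`, bounded modewise by Cauchy–Schwarz and Parseval (`≤ B·‖u(σ)‖·Σ_j‖∂_jψ‖`), while the drift-free adjoint
evolution does not increase any Fourier mode (`norm_sq_fcoeff_carrierFree_decay`), so `‖∇ψ(r)‖ ≤ ‖∇ζ‖`.  Result:
* **`abs_inner_sub_inner_driftFree_le`** — `|⟪U s t x, ζ⟫ − ⟪V s t x, ζ⟫| ≤ 3·B·(t − s)·‖x‖·√((eGradNormSq ζ).toReal)` (`√eGradNormSq = ‖∇·‖₂`) for `ζ ∈ V2`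
  weakly divergence free with finite enstrophy (e.g. a solenoidal real trigonometric polynomial), every `x ∈ V2`, `0 ≤ s ≤ t ≤ T₀`.
The tensor change `V ↦ T` (drift-free, another tensor) is diagonal in the modes and is the companion file's business.  `sorry`-free; NOT a proof of
any block, of the stub, of K1L_D or AD; rung F-D1.A0.
-/

set_option linter.dupNamespace false

noncomputable section

namespace Summit.AnomalousDissipation.AnomalousDissipation.Theorems.SolenoidalFractalHomogenisation.LagrangianStep.VmodFlat

open Literature.Analysis Literature.Analysis.FluidPDE Literature.Analysis.FunctionSpaces
open MeasureTheory Set Filter UnitAddTorus Complex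
open scoped ENNReal NNReal InnerProductSpace
open Summit.AnomalousDissipation.AnomalousDissipation.Theorems.SolenoidalFractalHomogenisation.LagrangianStep.CellClauseMod

/-! ## §1 The transport cross series at one time: a Cauchy–Schwarz bound -/

/-- An a.e.-bounded a.e.-strongly-measurable scalar multiplier times an `L²` field is in `L²`. [folklore] -/
theorem memLp_two_smul_ae {m : UnitAddTorus (Fin 3) → ℝ} {u : VF} {M : ℝ} (hm : AEStronglyMeasurable m volume)
    (hmM : ∀ᵐ x ∂volume, |m x| ≤ M) (hu : MemLp u 2 volume) : MemLp (fun x => m x • u x) 2 volume := by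
  refine MemLp.of_le_mul (c := M) hu (hm.smul hu.1) ?_
  filter_upwards [hmM] with x hx
  rw [norm_smul, Real.norm_eq_abs]
  exact mul_le_mul_of_nonneg_right hx (norm_nonneg _)

/-- `∫ ‖m u‖² ≤ M² ∫ ‖u‖²` for an a.e.-bounded multiplier. [folklore] -/
theorem integral_norm_sq_smul_le {m : UnitAddTorus (Fin 3) → ℝ} {u : VF} {M : ℝ} (hm : AEStronglyMeasurable m volume)
    (hmM : ∀ᵐ x ∂volume, |m x| ≤ M) (hu : MemLp u 2 volume) : ∫ x, ‖m x • u x‖ ^ 2 ≤ M ^ 2 * ∫ x, ‖u x‖ ^ 2 := by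
  have hmem := memLp_two_smul_ae hm hmM hu
  have hi1 : Integrable (fun x => ‖m x • u x‖ ^ 2) volume := (memLp_two_iff_integrable_sq_norm hmem.1).1 hmem
  have hi2 : Integrable (fun x => ‖u x‖ ^ 2) volume := (memLp_two_iff_integrable_sq_norm hu.1).1 hu
  rw [← MeasureTheory.integral_const_mul]
  refine integral_mono_ae hi1 (hi2.const_mul _) ?_
  filter_upwards [hmM] with x hx
  have hM0 : 0 ≤ M := (abs_nonneg _).trans hx
  rw [norm_smul, mul_pow, Real.norm_eq_abs]
  exact mul_le_mul_of_nonneg_right (pow_le_pow_left₀ (abs_nonneg _) hx 2) (sq_nonneg _)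

/-- **Transport cross series, one component**: for `|m| ≤ B` a.e., `u ∈ L²` and a finite-enstrophy `v ∈ L²`, every partial sum of
`Re(2πik_j⟨𝓕(m u)(k), v̂(k)⟩)` is bounded by `B·‖u‖₂·√(eGradNormSq v)` (Cauchy–Schwarz + Parseval, `|k_j| ≤ |k|`). [folklore] -/
theorem abs_sum_transportCross_le {m : UnitAddTorus (Fin 3) → ℝ} {u v : VF} {B : ℝ} (hm : AEStronglyMeasurable m volume)
    (hmB : ∀ᵐ y ∂volume, |m y| ≤ B) (hB : 0 ≤ B) (hu : MemLp u 2 volume) (hv1 : Torus.eGradNormSq v ≠ ⊤) (j : Fin 3)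
    (F : Finset (Fin 3 → ℤ)) :
    |∑ k ∈ F, ((2 * Real.pi * I * (k j)) *
        ⟪mFourierCoeff (EuclideanSpace.complexify ∘ fun y => m y • u y) k, mFourierCoeff (EuclideanSpace.complexify ∘ v) k⟫_ℂ).re| ≤
      B * Real.sqrt (∫ y, ‖u y‖ ^ 2) * Real.sqrt ((Torus.eGradNormSq v).toReal) := by
  set a : (Fin 3 → ℤ) → EuclideanSpace ℂ (Fin 3) := fun k => mFourierCoeff (EuclideanSpace.complexify ∘ fun y => m y • u y) k with ha
  set w : (Fin 3 → ℤ) → EuclideanSpace ℂ (Fin 3) := fun k => mFourierCoeff (EuclideanSpace.complexify ∘ v) k with hw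
  have hmu : MemLp (fun y => m y • u y) 2 volume := memLp_two_smul_ae hm hmB hu
  -- termwise bound `|Re(2πik_j⟨a_k, w_k⟩)| ≤ (2π‖a_k‖)·(|k_j|‖w_k‖)`
  have hterm : ∀ k ∈ F, |((2 * Real.pi * I * (k j)) * ⟪a k, w k⟫_ℂ).re| ≤ (2 * Real.pi * ‖a k‖) * (|(k j : ℝ)| * ‖w k‖) := by
    intro k _
    refine (Complex.abs_re_le_norm _).trans ?_
    rw [norm_mul]
    have h1 : ‖(2 * Real.pi * I * (k j) : ℂ)‖ = 2 * Real.pi * |(k j : ℝ)| := by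
      rw [norm_mul, norm_mul, norm_mul, Complex.norm_I, mul_one, Complex.norm_ofNat, Complex.norm_real, Real.norm_eq_abs,
        abs_of_pos Real.pi_pos, Complex.norm_intCast]
    rw [h1]
    have h2 : ‖⟪a k, w k⟫_ℂ‖ ≤ ‖a k‖ * ‖w k‖ := norm_inner_le_norm _ _
    have : 0 ≤ 2 * Real.pi * |(k j : ℝ)| := by positivity
    nlinarith [norm_nonneg (a k), norm_nonneg (w k), this]
  -- Cauchy–Schwarz over `F`
  have hCS := Real.sum_mul_le_sqrt_mul_sqrt F (fun k => 2 * Real.pi * ‖a k‖) (fun k => |(k j : ℝ)| * ‖w k‖)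
  -- Parseval bounds of the two square sums
  have hA : ∑ k ∈ F, (2 * Real.pi * ‖a k‖) ^ 2 ≤ (2 * Real.pi) ^ 2 * (B ^ 2 * ∫ y, ‖u y‖ ^ 2) := by
    have hP := Torus.hasSum_sq_norm_mFourierCoeff_complexify hmu
    have h1 : ∑ k ∈ F, ‖a k‖ ^ 2 ≤ ∫ y, ‖m y • u y‖ ^ 2 :=
      sum_le_hasSum F (fun k _ => sq_nonneg _) hP
    have h2 := integral_norm_sq_smul_le hm hmB hu
    calc ∑ k ∈ F, (2 * Real.pi * ‖a k‖) ^ 2 = (2 * Real.pi) ^ 2 * ∑ k ∈ F, ‖a k‖ ^ 2 := by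
          rw [Finset.mul_sum]; exact Finset.sum_congr rfl fun k _ => by ring
      _ ≤ (2 * Real.pi) ^ 2 * (B ^ 2 * ∫ y, ‖u y‖ ^ 2) := mul_le_mul_of_nonneg_left (h1.trans h2) (by positivity)
  have hW : ∑ k ∈ F, (|(k j : ℝ)| * ‖w k‖) ^ 2 ≤ (Torus.eGradNormSq v).toReal / (4 * Real.pi ^ 2) := by
    have hP := Torus.hasSum_freqNormSq_mul_sq_norm v hv1
    have h1 : ∑ k ∈ F, Torus.freqNormSq k * ‖w k‖ ^ 2 ≤ (Torus.eGradNormSq v).toReal / (4 * Real.pi ^ 2) :=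
      sum_le_hasSum F (fun k _ => mul_nonneg (Torus.freqNormSq_nonneg k) (sq_nonneg _)) hP
    refine le_trans (Finset.sum_le_sum fun k _ => ?_) h1
    rw [mul_pow, sq_abs]
    refine mul_le_mul_of_nonneg_right ?_ (sq_nonneg _)
    rw [Torus.freqNormSq]
    exact Finset.single_le_sum (f := fun i => ((k i : ℝ)) ^ 2) (fun i _ => sq_nonneg _) (Finset.mem_univ j)
  have hu0 : 0 ≤ ∫ y, ‖u y‖ ^ 2 := integral_nonneg fun y => sq_nonneg _
  calc |∑ k ∈ F, ((2 * Real.pi * I * (k j)) * ⟪a k, w k⟫_ℂ).re|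
      ≤ ∑ k ∈ F, |((2 * Real.pi * I * (k j)) * ⟪a k, w k⟫_ℂ).re| := Finset.abs_sum_le_sum_abs _ _
    _ ≤ ∑ k ∈ F, (2 * Real.pi * ‖a k‖) * (|(k j : ℝ)| * ‖w k‖) := Finset.sum_le_sum hterm
    _ ≤ Real.sqrt (∑ k ∈ F, (2 * Real.pi * ‖a k‖) ^ 2) * Real.sqrt (∑ k ∈ F, (|(k j : ℝ)| * ‖w k‖) ^ 2) := hCS
    _ ≤ Real.sqrt ((2 * Real.pi) ^ 2 * (B ^ 2 * ∫ y, ‖u y‖ ^ 2)) * Real.sqrt ((Torus.eGradNormSq v).toReal / (4 * Real.pi ^ 2)) :=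
        mul_le_mul (Real.sqrt_le_sqrt hA) (Real.sqrt_le_sqrt hW) (Real.sqrt_nonneg _) (Real.sqrt_nonneg _)
    _ = B * Real.sqrt (∫ y, ‖u y‖ ^ 2) * Real.sqrt ((Torus.eGradNormSq v).toReal) := by
        have hpi : (0:ℝ) < 2 * Real.pi := by positivity
        have e1 : Real.sqrt ((2 * Real.pi) ^ 2 * (B ^ 2 * ∫ y, ‖u y‖ ^ 2)) = 2 * Real.pi * (B * Real.sqrt (∫ y, ‖u y‖ ^ 2)) := by
          rw [Real.sqrt_mul (sq_nonneg _), Real.sqrt_sq hpi.le, Real.sqrt_mul (sq_nonneg _), Real.sqrt_sq hB]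
        have e2 : Real.sqrt ((Torus.eGradNormSq v).toReal / (4 * Real.pi ^ 2)) =
            Real.sqrt ((Torus.eGradNormSq v).toReal) / (2 * Real.pi) := by
          rw [Real.sqrt_div ENNReal.toReal_nonneg, show (4:ℝ) * Real.pi ^ 2 = (2 * Real.pi) ^ 2 by ring, Real.sqrt_sq hpi.le]
        rw [e1, e2]
        field_simp

/-- From a uniform bound on all partial sums to a bound on the sum. [folklore] -/
theorem abs_le_of_hasSum_of_forall_abs_sum_le {f : (Fin 3 → ℤ) → ℝ} {a M : ℝ} (h : HasSum f a)
    (hF : ∀ F : Finset (Fin 3 → ℤ), |∑ k ∈ F, f k| ≤ M) : |a| ≤ M := by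
  have ht : Filter.Tendsto (fun F : Finset (Fin 3 → ℤ) => |∑ k ∈ F, f k|) Filter.atTop (nhds |a|) :=
    (continuous_abs.tendsto a).comp h
  exact le_of_tendsto' ht hF

/-! ## §2 Enstrophy is not increased by the drift-free propagator (modewise) -/

/-- Along a drift-free propagator every mode is non-increasing, hence so is the spectral gradient norm:
`eGradNormSq (U s t x) ≤ eGradNormSq x` for weakly divergence-free `x`. [folklore] -/
theorem eGradNormSq_driftFree_le {T₀ : ℝ} {𝔹 : Torus.Visc4 (Fin 3)} {lo' hi' : ℝ} (h𝔹 : Torus.NearIso 𝔹 lo' hi') (hlo' : 0 < lo')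
    {U : ℝ → ℝ → (V2 →L[ℝ] V2)}
    (hU : Torus.IsPropagator T₀ (fun (_ : ℝ) (_ : UnitAddTorus (Fin 3)) => (0 : EuclideanSpace ℝ (Fin 3))) 𝔹 U)
    {s t : ℝ} (hs : 0 ≤ s) (hst : s ≤ t) (htT : t ≤ T₀) (hsT : s < T₀) (x : V2) (hx : Torus.IsWeaklyDivFree (x : VF)) :
    Torus.eGradNormSq ((U s t x : V2) : VF) ≤ Torus.eGradNormSq (x : VF) := by
  rw [Torus.eGradNormSq_eq_tsum, Torus.eGradNormSq_eq_tsum]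
  gcongr with k
  have h := norm_sq_fcoeff_carrierFree_decay h𝔹 hlo' hU hs hst htT hsT x hx k
  have hE : Real.exp (-(8 * Real.pi ^ 2 * lo' * Torus.freqNormSq k * (t - s))) ≤ 1 := by
    rw [Real.exp_le_one_iff]
    have : 0 ≤ 8 * Real.pi ^ 2 * lo' * Torus.freqNormSq k * (t - s) :=
      mul_nonneg (mul_nonneg (by positivity) (Torus.freqNormSq_nonneg k)) (by linarith)
    linarith
  have h2 : ‖fc (U s t x) k‖ ^ 2 ≤ ‖fc x k‖ ^ 2 := h.trans (by nlinarith [sq_nonneg ‖fc x k‖])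
  have h3 : ‖fc (U s t x) k‖ ≤ ‖fc x k‖ := by
    have := Real.sqrt_le_sqrt h2
    rwa [Real.sqrt_sq (norm_nonneg _), Real.sqrt_sq (norm_nonneg _)] at this
  rw [← ofReal_norm, ← ofReal_norm]
  exact ENNReal.ofReal_le_ofReal h3

/-! ## §3 The transport-only duality bound -/

set_option maxHeartbeats 800000 in
/-- **TRANSPORT-ONLY DUALITY BOUND.**  Let `U` be the window propagator of the tensor passive-vector problem with an elliptic constant tensor `𝔹`
and a carrier `b` (essentially bounded, `‖b‖ ≤ B` a.e., a.e. weakly divergence free), and `V` the propagator of the SAME tensor WITHOUT drift.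
Then for every `x ∈ L²`, every weakly divergence-free `ζ ∈ L²` of finite enstrophy and `0 ≤ s ≤ t ≤ T₀`:
`|⟪U s t x, ζ⟫ − ⟪V s t x, ζ⟫| ≤ 3·B·(t − s)·‖x‖·√(eGradNormSq ζ)` — the two-problem duality (Temam III.1.2, traces included) against the drift-free
adjoint evolution of `ζ` has no viscous cross term, its transport cross series is bounded by `B·‖u(σ)‖₂·√(eGradNormSq ψ(t₀−σ))` per component (§1),
`‖u(σ)‖₂ ≤ ‖x‖` (contraction) and `eGradNormSq ψ(·) ≤ eGradNormSq ζ` (§2). [folklore] -/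
theorem abs_inner_sub_inner_driftFree_le {T₀ : ℝ} {𝔹 : Torus.Visc4 (Fin 3)} {lo' hi' : ℝ} (h𝔹 : Torus.NearIso 𝔹 lo' hi') (hlo' : 0 < lo')
    {b : ℝ → VF} (hb : MemLp (Torus.stLift b) ∞ (volume.restrict (Ioo 0 T₀ ×ˢ (univ : Set (EuclideanSpace ℝ (Fin 3))))))
    (hbdiv : ∀ᵐ τ ∂(volume.restrict (Ioo (0:ℝ) T₀)), Torus.IsWeaklyDivFree (b τ))
    {B : ℝ} (hB : 0 ≤ B) (hbB : ∀ᵐ τ ∂(volume.restrict (Ioo (0:ℝ) T₀)), ∀ᵐ y ∂volume, ‖b τ y‖ ≤ B)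
    {U V : ℝ → ℝ → (V2 →L[ℝ] V2)} (hU : Torus.IsPropagator T₀ b 𝔹 U)
    (hV : Torus.IsPropagator T₀ (fun (_ : ℝ) (_ : UnitAddTorus (Fin 3)) => (0 : EuclideanSpace ℝ (Fin 3))) 𝔹 V)
    {s t : ℝ} (hs : 0 ≤ s) (hst : s ≤ t) (htT : t ≤ T₀) (x ζ : V2) (hζdiv : Torus.IsWeaklyDivFree (ζ : VF))
    (hζ1 : Torus.eGradNormSq (ζ : VF) ≠ ⊤) :
    |⟪U s t x, ζ⟫_ℝ - ⟪V s t x, ζ⟫_ℝ| ≤ 3 * B * (t - s) * ‖x‖ * Real.sqrt ((Torus.eGradNormSq (ζ : VF)).toReal) := by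
  set P := (Torus.divFreeL2 (Fin 3)).starProjection with hP
  -- the case `t = s`: both maps are the Leray projection
  rcases hst.eq_or_lt with heq | hst'
  · subst heq
    have hPdiv : Torus.IsWeaklyDivFree (⇑(P x) : VF) := Torus.isWeaklyDivFree_starProjection x
    have eU : U s s x = P x := by rw [hU.apply_eq_apply_starProjection s s x]; exact hU.self_of_divFree s hs htT (P x) hPdiv
    have eV : V s s x = P x := by rw [hV.apply_eq_apply_starProjection s s x]; exact hV.self_of_divFree s hs htT (P x) hPdiv
    rw [eU, eV, sub_self, abs_zero, sub_self]
    simp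
  have hsT : s < T₀ := hst'.trans_le htT
  set E : ℝ := Real.sqrt ((Torus.eGradNormSq (ζ : VF)).toReal) with hEdef
  set t₀ : ℝ := t - s with ht₀def
  have ht₀ : 0 < t₀ := sub_pos.2 hst'
  set L : ℝ := T₀ - s with hLdef
  have ht₀L : t₀ ≤ L := by rw [ht₀def, hLdef]; linarith
  -- the datum `y = P x` as a function
  set y : VF := ((P x : V2) : VF) with hydef
  have hy : MemLp y 2 volume := Lp.memLp (P x)
  have hydiv : Torus.IsWeaklyDivFree y := Torus.isWeaklyDivFree_starProjection x
  have hPy : hy.toLp y = P x := Lp.toLp_coeFn (P x) hy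
  have hPn : ‖P x‖ ≤ ‖x‖ := (Torus.divFreeL2 (Fin 3)).norm_starProjection_apply_le x
  -- the shifted carrier on the `u`-horizon `L = T₀ − s`, and the zero carriers
  have hb' := Torus.memLp_top_stLift_shift_window (T := T₀) (b := b) hb hs
  have hb'B : ∀ᵐ σ ∂(volume.restrict (Ioo (0:ℝ) L)), ∀ᵐ yy ∂volume, ‖b (s + σ) yy‖ ≤ B :=
    Torus.ae_restrict_Ioo_comp_add_left (P := fun τ => ∀ᵐ yy ∂volume, ‖b τ yy‖ ≤ B) hbB hs (by rw [hLdef]; linarith)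
  have hz : MemLp (Torus.stLift (fun (_ : ℝ) (_ : UnitAddTorus (Fin 3)) => (0 : EuclideanSpace ℝ (Fin 3)))) ∞
      (volume.restrict (Ioo (0:ℝ) L ×ˢ (univ : Set (EuclideanSpace ℝ (Fin 3))))) := memLp_top_const 0
  have hz' : MemLp (Torus.stLift (fun (τ : ℝ) => (fun (_ : ℝ) (_ : UnitAddTorus (Fin 3)) => (0 : EuclideanSpace ℝ (Fin 3))) (s + τ))) ∞
      (volume.restrict (Ioo (0:ℝ) L ×ˢ (univ : Set (EuclideanSpace ℝ (Fin 3))))) := memLp_top_const 0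
  have hbV : MemLp (Torus.stLift (fun (_ : ℝ) (_ : UnitAddTorus (Fin 3)) => (0 : EuclideanSpace ℝ (Fin 3)))) ∞
      (volume.restrict (Ioo (0:ℝ) T₀ ×ˢ (univ : Set (EuclideanSpace ℝ (Fin 3))))) := memLp_top_const 0
  have hbVdiv : ∀ᵐ τ ∂(volume.restrict (Ioo (0:ℝ) T₀)),
      Torus.IsWeaklyDivFree ((fun (_ : ℝ) (_ : UnitAddTorus (Fin 3)) => (0 : EuclideanSpace ℝ (Fin 3))) τ) :=
    ae_of_all _ fun τ θ hθ => by simp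
  have hbW : MemLp (Torus.stLift (fun (_ : ℝ) (_ : UnitAddTorus (Fin 3)) => (0 : EuclideanSpace ℝ (Fin 3)))) ∞
      (volume.restrict (Ioo (0:ℝ) t₀ ×ˢ (univ : Set (EuclideanSpace ℝ (Fin 3))))) := memLp_top_const 0
  have hbWdiv : ∀ᵐ τ ∂(volume.restrict (Ioo (0:ℝ) t₀)),
      Torus.IsWeaklyDivFree ((fun (_ : ℝ) (_ : UnitAddTorus (Fin 3)) => (0 : EuclideanSpace ℝ (Fin 3))) τ) :=
    ae_of_all _ fun τ θ hθ => by simp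
  -- the two window solutions from `y`: along `b` (for `U`) and along `0` (for `V`)
  have hu := Torus.windowSol_spec h𝔹 hlo' hb hbdiv hs hsT hy hydiv
  set u := Torus.windowSol h𝔹 hlo' hb hbdiv hs hsT hy hydiv with hudef
  have huV := Torus.windowSol_spec h𝔹 hlo' hbV hbVdiv hs hsT hy hydiv
  set uV := Torus.windowSol h𝔹 hlo' hbV hbVdiv hs hsT hy hydiv with huVdef
  have hb'm : ∀ᵐ σ ∂(volume.restrict (Ioo (0:ℝ) L)), AEStronglyMeasurable (b (s + σ)) volume :=
    hu.ae_aestronglyMeasurable_slice.mono fun σ h => h.2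
  -- the adjoint drift-free propagator on the horizon `t₀`, and its window solution from `ζ`
  have h𝔹T : Torus.NearIso (Torus.majorTranspose 𝔹) lo' hi' := (Torus.nearIso_majorTranspose_iff 𝔹 lo' hi').2 h𝔹
  obtain ⟨W, hW⟩ := Torus.exists_isPropagator h𝔹T hlo' hbW hbWdiv
  have hζm : MemLp ((ζ : V2) : VF) 2 volume := Lp.memLp ζ
  have hζLp : hζm.toLp ((ζ : V2) : VF) = ζ := Lp.toLp_coeFn ζ hζm
  have hψ0 := Torus.windowSol_spec h𝔹T hlo' hbW hbWdiv le_rfl ht₀ hζm hζdiv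
  set ψ := Torus.windowSol h𝔹T hlo' hbW hbWdiv le_rfl ht₀ hζm hζdiv with hψdef
  have ecar : (fun r : ℝ => -((fun (_ : ℝ) (_ : UnitAddTorus (Fin 3)) => (0 : EuclideanSpace ℝ (Fin 3))) (t₀ - r))) =
      (fun τ : ℝ => (fun (_ : ℝ) (_ : UnitAddTorus (Fin 3)) => (0 : EuclideanSpace ℝ (Fin 3))) (0 + τ)) := by
    funext r yy; simp
  have key : ∀ (T' : ℝ) (car : ℝ → VF), T' = t₀ - 0 →
      car = (fun τ : ℝ => (fun (_ : ℝ) (_ : UnitAddTorus (Fin 3)) => (0 : EuclideanSpace ℝ (Fin 3))) (0 + τ)) →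
      Torus.IsWeakTensorPassiveVectorOn 0 (t₀ - 0) (Torus.majorTranspose 𝔹)
        (fun τ : ℝ => (fun (_ : ℝ) (_ : UnitAddTorus (Fin 3)) => (0 : EuclideanSpace ℝ (Fin 3))) (0 + τ)) ((ζ : V2) : VF) ψ →
      Torus.IsWeakTensorPassiveVectorOn 0 T' (Torus.majorTranspose 𝔹) car ((ζ : V2) : VF) ψ := by
    rintro _ _ rfl rfl h; exact h
  have hψ : Torus.IsWeakTensorPassiveVectorOn 0 t₀ (Torus.majorTranspose 𝔹)
      (fun r : ℝ => -((fun (_ : ℝ) (_ : UnitAddTorus (Fin 3)) => (0 : EuclideanSpace ℝ (Fin 3))) (t₀ - r))) ((ζ : V2) : VF) ψ :=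
    key t₀ _ (sub_zero t₀).symm ecar hψ0
  -- the common pairing `h r = ⟪W 0 r ζ, P x⟫` and its a.e. identification
  set h : ℝ → ℝ := fun r => ⟪W 0 r ζ, P x⟫_ℝ with hhdef
  have hhc : ContinuousOn h (Icc 0 t₀) := hW.continuousOn 0 le_rfl ht₀.le ζ (P x)
  have hreprW := hW.repr 0 le_rfl ht₀ ((ζ : V2) : VF) hζm hζdiv ψ hψ0
  have hsub0 : Ioo (0:ℝ) t₀ ⊆ Ioo 0 (t₀ - 0) := by rw [sub_zero]
  have hh_ae : ∀ᵐ r ∂(volume.restrict (Ioo (0:ℝ) t₀)), ∫ yy, ⟪ψ r yy, y yy⟫_ℝ = h r := by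
    filter_upwards [ae_restrict_of_ae_restrict_of_subset hsub0 hreprW] with r hr
    obtain ⟨hrm, hre⟩ := hr
    rw [zero_add, hζLp] at hre
    have hae : ψ r =ᵐ[volume] ((W 0 r ζ : V2) : VF) := by rw [← hre]; exact hrm.coeFn_toLp.symm
    show ∫ yy, ⟪ψ r yy, y yy⟫_ℝ = ⟪W 0 r ζ, P x⟫_ℝ
    rw [MeasureTheory.L2.inner_def]
    exact integral_congr_ae (hae.mono fun yy hyy => by simp only [hyy, hydef])
  -- ### the duality for `U` (tensors equal: no viscous cross term) and for `V` (no cross term at all)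
  obtain ⟨G, -, hGsum, c, -, hg, hh⟩ := hu.exists_integrableOn_hasSum_cross_sub_traces ht₀ ht₀L hψ h𝔹 h𝔹 hlo' hy hydiv hζm hζdiv
    hb' hz
  obtain ⟨G', -, hG'sum, c', -, hg', hh'⟩ := huV.exists_integrableOn_hasSum_cross_sub_traces ht₀ ht₀L hψ h𝔹 h𝔹 hlo' hy hydiv hζm
    hζdiv hz' hz
  have hc : h t₀ = c := hh h hhc hh_ae
  have hc' : h t₀ = c' := hh' h hhc hh_ae
  -- `g`, `g'`: the pairings along `U`, `V`
  have hmaps : MapsTo (fun r : ℝ => s + r) (Icc 0 L) (Icc s T₀) := by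
    intro r hr; exact ⟨by linarith [hr.1], by rw [hLdef] at hr; linarith [hr.2]⟩
  set g : ℝ → ℝ := fun r => ⟪U s (s + r) x, ζ⟫_ℝ with hgdef
  have hgc : ContinuousOn g (Icc 0 L) :=
    (hU.continuousOn s hs hsT.le x ζ).comp (continuous_const.add continuous_id).continuousOn hmaps
  have hreprU := hU.repr s hs hsT y hy hydiv u hu
  have hg_ae : ∀ᵐ r ∂(volume.restrict (Ioo (0:ℝ) L)), ∫ yy, ⟪u r yy, ((ζ : V2) : VF) yy⟫_ℝ = g r := by
    filter_upwards [hreprU] with r hr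
    obtain ⟨hrm, hre⟩ := hr
    rw [hPy, ← hU.apply_eq_apply_starProjection s (s + r) x] at hre
    have hae : u r =ᵐ[volume] ((U s (s + r) x : V2) : VF) := by rw [← hre]; exact hrm.coeFn_toLp.symm
    show ∫ yy, ⟪u r yy, ((ζ : V2) : VF) yy⟫_ℝ = ⟪U s (s + r) x, ζ⟫_ℝ
    rw [MeasureTheory.L2.inner_def]
    exact integral_congr_ae (hae.mono fun yy hyy => by simp only [hyy])
  have hgU : g t₀ = c + ∫ σ in Ioc 0 t₀, G σ := hg g hgc hg_ae
  set g' : ℝ → ℝ := fun r => ⟪V s (s + r) x, ζ⟫_ℝ with hg'def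
  have hg'c : ContinuousOn g' (Icc 0 L) :=
    (hV.continuousOn s hs hsT.le x ζ).comp (continuous_const.add continuous_id).continuousOn hmaps
  have hreprV := hV.repr s hs hsT y hy hydiv uV huV
  have hg'_ae : ∀ᵐ r ∂(volume.restrict (Ioo (0:ℝ) L)), ∫ yy, ⟪uV r yy, ((ζ : V2) : VF) yy⟫_ℝ = g' r := by
    filter_upwards [hreprV] with r hr
    obtain ⟨hrm, hre⟩ := hr
    rw [hPy, ← hV.apply_eq_apply_starProjection s (s + r) x] at hre
    have hae : uV r =ᵐ[volume] ((V s (s + r) x : V2) : VF) := by rw [← hre]; exact hrm.coeFn_toLp.symm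
    show ∫ yy, ⟪uV r yy, ((ζ : V2) : VF) yy⟫_ℝ = ⟪V s (s + r) x, ζ⟫_ℝ
    rw [MeasureTheory.L2.inner_def]
    exact integral_congr_ae (hae.mono fun yy hyy => by simp only [hyy])
  have hgV : g' t₀ = c' + ∫ σ in Ioc 0 t₀, G' σ := hg' g' hg'c hg'_ae
  -- `G' = 0` a.e., hence `∫ G' = 0`
  have h0F : ∀ k : Fin 3 → ℤ,
      mFourierCoeff (EuclideanSpace.complexify ∘ fun _ : UnitAddTorus (Fin 3) => (0 : EuclideanSpace ℝ (Fin 3))) k = 0 := fun k => by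
    simp [mFourierCoeff]
  have hG'0 : ∀ᵐ σ ∂(volume.restrict (Ioo (0:ℝ) t₀)), G' σ = 0 := by
    filter_upwards [hG'sum] with σ hσ
    have h0 : HasSum (fun _ : Fin 3 → ℤ => (0:ℝ)) (G' σ) := by
      refine hσ.congr_fun fun k => ?_
      simp [h0F]
    exact h0.unique hasSum_zero
  have hIG' : ∫ σ in Ioc 0 t₀, G' σ = 0 := by
    rw [integral_Ioc_eq_integral_Ioo]
    exact integral_eq_zero_of_ae hG'0
  -- ### the pointwise bound `|G σ| ≤ 3 B ‖x‖ E` for a.e. `σ ∈ (0, t₀)`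
  have hsub : Ioo (0:ℝ) t₀ ⊆ Ioo 0 L := Ioo_subset_Ioo le_rfl ht₀L
  have hreprW0 : ∀ᵐ σ ∂(volume.restrict (Ioo (0:ℝ) t₀)),
      ∃ hτ : MemLp (ψ (t₀ - σ)) 2 volume, hτ.toLp (ψ (t₀ - σ)) = W 0 (0 + (t₀ - σ)) (hζm.toLp ((ζ : V2) : VF)) := by
    have hmp : MeasurePreserving (fun r : ℝ => t₀ - r) (volume.restrict (Ioo 0 t₀)) (volume.restrict (Ioo 0 t₀)) := by
      have h1 := (Measure.measurePreserving_sub_left (volume : Measure ℝ) t₀).restrict_preimage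
        (measurableSet_Ioo (a := (0:ℝ)) (b := t₀))
      have hpre : (fun r : ℝ => t₀ - r) ⁻¹' Ioo 0 t₀ = Ioo 0 t₀ := by
        ext r; simp only [mem_preimage, mem_Ioo]; constructor <;> rintro ⟨h1, h2⟩ <;> constructor <;> linarith
      rwa [hpre] at h1
    exact hmp.quasiMeasurePreserving.ae (ae_restrict_of_ae_restrict_of_subset hsub0 hreprW)
  have hGbound : ∀ᵐ σ ∂(volume.restrict (Ioo (0:ℝ) t₀)), |G σ| ≤ 3 * B * ‖x‖ * E := by
    filter_upwards [hGsum, ae_restrict_of_ae_restrict_of_subset hsub hb'B, ae_restrict_of_ae_restrict_of_subset hsub hb'm,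
      ae_restrict_of_ae_restrict_of_subset hsub hreprU, hreprW0, ae_restrict_mem measurableSet_Ioo] with σ hσ hBσ hmσ hUσ hWσ hσmem
    obtain ⟨huσ2, hueq⟩ := hUσ
    obtain ⟨hψσ2, hψeq⟩ := hWσ
    -- `‖u σ‖₂ ≤ ‖x‖`
    have hu_norm : Real.sqrt (∫ yy, ‖u σ yy‖ ^ 2) ≤ ‖x‖ := by
      rw [← Torus.norm_toLp_sq_eq_integral huσ2, Real.sqrt_sq (norm_nonneg _), hueq, hPy]
      exact (hU.norm_le _ _ _).trans hPn
    -- `eGradNormSq (ψ (t₀ − σ)) ≤ eGradNormSq ζ`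
    have hψae : ψ (t₀ - σ) =ᵐ[volume] ((W 0 (t₀ - σ) ζ : V2) : VF) := by
      rw [zero_add, hζLp] at hψeq
      rw [← hψeq]; exact hψσ2.coeFn_toLp.symm
    have hgradle : Torus.eGradNormSq (ψ (t₀ - σ)) ≤ Torus.eGradNormSq ((ζ : V2) : VF) := by
      rw [N1Assembly.eGradNormSq_congr_ae_VF hψae]
      exact eGradNormSq_driftFree_le h𝔹T hlo' hW le_rfl (by linarith [hσmem.2]) (by linarith [hσmem.1]) ht₀ ζ hζdiv
    have hψtop : Torus.eGradNormSq (ψ (t₀ - σ)) ≠ ⊤ := ne_top_of_le_ne_top hζ1 hgradle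
    have hEσ : Real.sqrt ((Torus.eGradNormSq (ψ (t₀ - σ))).toReal) ≤ E := Real.sqrt_le_sqrt (ENNReal.toReal_mono hζ1 hgradle)
    -- the components of the carrier
    have hmB : ∀ j : Fin 3, ∀ᵐ yy ∂volume, |b (s + σ) yy j| ≤ B := fun j =>
      hBσ.mono fun yy hyy => by
        have h1 := PiLp.norm_apply_le (b (s + σ) yy) j
        rw [Real.norm_eq_abs] at h1
        exact h1.trans hyy
    have hmeas : ∀ j : Fin 3, AEStronglyMeasurable (fun yy => b (s + σ) yy j) volume := fun j =>
      (EuclideanSpace.proj j).continuous.comp_aestronglyMeasurable hmσ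
    -- the summand, component by component
    set f : Fin 3 → (Fin 3 → ℤ) → ℝ := fun j k => ((2 * Real.pi * I * (k j)) *
      ⟪mFourierCoeff (EuclideanSpace.complexify ∘ fun yy => b (s + σ) yy j • u σ yy) k,
        mFourierCoeff (EuclideanSpace.complexify ∘ ψ (t₀ - σ)) k⟫_ℂ).re with hfdef
    have hσ' : HasSum (fun k : Fin 3 → ℤ => ∑ j : Fin 3, f j k) (G σ) := by
      refine hσ.congr_fun fun k => ?_
      rw [sub_self, inner_zero_right, mul_zero, zero_add, Complex.re_sum]
      refine Finset.sum_congr rfl fun j _ => ?_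
      simp only [hfdef, WithLp.ofLp_zero, Pi.zero_apply, sub_zero]
    have hF : ∀ F : Finset (Fin 3 → ℤ), |∑ k ∈ F, ∑ j : Fin 3, f j k| ≤ 3 * B * ‖x‖ * E := by
      intro F
      rw [Finset.sum_comm]
      refine (Finset.abs_sum_le_sum_abs _ _).trans ?_
      have hj : ∀ j ∈ (Finset.univ : Finset (Fin 3)), |∑ k ∈ F, f j k| ≤ B * ‖x‖ * E := by
        intro j _
        refine (abs_sum_transportCross_le (hmeas j) (hmB j) hB huσ2 hψtop j F).trans ?_
        have h1 : 0 ≤ Real.sqrt (∫ yy, ‖u σ yy‖ ^ 2) := Real.sqrt_nonneg _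
        have h2 : 0 ≤ Real.sqrt ((Torus.eGradNormSq (ψ (t₀ - σ))).toReal) := Real.sqrt_nonneg _
        calc B * Real.sqrt (∫ yy, ‖u σ yy‖ ^ 2) * Real.sqrt ((Torus.eGradNormSq (ψ (t₀ - σ))).toReal)
            ≤ B * ‖x‖ * Real.sqrt ((Torus.eGradNormSq (ψ (t₀ - σ))).toReal) :=
              mul_le_mul_of_nonneg_right (mul_le_mul_of_nonneg_left hu_norm hB) h2
          _ ≤ B * ‖x‖ * E := mul_le_mul_of_nonneg_left hEσ (mul_nonneg hB (norm_nonneg _))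
      refine (Finset.sum_le_sum hj).trans ?_
      rw [Finset.sum_const, Finset.card_univ, Fintype.card_fin, nsmul_eq_mul]
      push_cast
      exact le_of_eq (by ring)
    exact abs_le_of_hasSum_of_forall_abs_sum_le hσ' hF
  -- ### assembling
  have hE0 : 0 ≤ 3 * B * ‖x‖ * E := by positivity
  have hInt : |∫ σ in Ioc 0 t₀, G σ| ≤ 3 * B * ‖x‖ * E * t₀ := by
    rw [integral_Ioc_eq_integral_Ioo]
    have h1 := norm_setIntegral_le_of_norm_le_const_ae (μ := (volume : Measure ℝ)) (s := Ioo (0:ℝ) t₀) (f := G)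
      (C := 3 * B * ‖x‖ * E) measure_Ioo_lt_top (hGbound.mono fun σ hσ => by rw [Real.norm_eq_abs]; exact hσ)
    rw [Real.norm_eq_abs, Real.volume_real_Ioo_of_le ht₀.le, sub_zero] at h1
    exact h1
  have hst₀ : s + t₀ = t := by rw [ht₀def]; ring
  have hgt : g t₀ = ⟪U s t x, ζ⟫_ℝ := by rw [hgdef]; simp only [hst₀]
  have hg't : g' t₀ = ⟪V s t x, ζ⟫_ℝ := by rw [hg'def]; simp only [hst₀]
  have hdiff : ⟪U s t x, ζ⟫_ℝ - ⟪V s t x, ζ⟫_ℝ = ∫ σ in Ioc 0 t₀, G σ := by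
    rw [← hgt, ← hg't, hgU, hgV, hIG', ← hc, ← hc']; ring
  rw [hdiff]
  calc |∫ σ in Ioc 0 t₀, G σ| ≤ 3 * B * ‖x‖ * E * t₀ := hInt
    _ = 3 * B * t₀ * ‖x‖ * E := by ring

end Summit.AnomalousDissipation.AnomalousDissipation.Theorems.SolenoidalFractalHomogenisation.LagrangianStep.VmodFlat

end
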